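import Mathlib
import Literature.Analysis.SpecialFunctions.DilogarithmRealArgument
import Literature.NumberTheory.Transcendental.IdealTetrahedronVolumeIntegral
import HarnessLib

/-!
# Level-1 sum rule of the wedge dictionary, I: one-variable dilogarithmic inputs (cell `pub-zeta5`, seat ct-1 g20)

HONEST FRAMING: systematic search; no irrationality claim unless certified.  Elementary real analysis only: the
one-variable integrals that feed the last step of the level-1 SUM RULE
`I(1,0,1,0,1,1,1,1) + I(1,0,1,0,1,1,0,1) = 5/6 − ζ(2)/3` for Brown–Zudilin's cellular integrals
(`WedgeDictionarySumRule`; gen-1 g17 `LEVEL1-EXACT.md` Corollary C, here by an elementary route whose only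
transcendental input is `∫₀¹ log(1−t)/t dt = −π²/6`, i.e. the tree's `reDilog_one`
[`Literature.Analysis.SpecialFunctions.DilogarithmRealArgument`]):

* `∫₀¹ log(1−t)/t = −π²/6`, `∫₀¹ log t/(1−t) = −π²/6`, `∫₀¹ log t = ∫₀¹ log(1−t) = −1`, with interval-integrability;
* the singular combination `u₄(t) = log t/(1−t)² + 1/(1−t)` (primitive `t log t/(1−t)`, continuous extension to `[0,1]`):
  `∫₀¹ u₄ = −1`, integrable because `u₄ ≤ 0` is the derivative of a continuous function (`intervalIntegrable_deriv_of_nonneg`);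
* the last integrand of the sum rule, `G₄(a) = 1/2 + (1−a)log(1−a)/(6a) − 1/(3(1−a)) + a(a−3)log a/(6(1−a)²)` (a local notation),
  its decomposition into the five pieces on `(0,1)` and **`integral_G4 : ∫_{(0,1)} G₄ = 5/6 − π²/18`** with integrability.

Nothing here mentions the cellular integrals; nothing about `ζ(5)`.  Theorems only (the two auxiliary functions are local notations).
-/

noncomputable section

open MeasureTheory Set Filter Topology intervalIntegral

namespace Summit.KontsevichZagierPeriods.Zeta5Search.WedgeDictionarySumRule

open Literature.Analysis.SpecialFunctions (reDilog reDilog_one reDilog_def)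
open Literature.NumberTheory.Transcendental.BlochWignerVolume (intervalIntegrable_log_one_sub)

/-- `t ↦ log(1−t)/t` is interval-integrable on `[0, 1]`. [folklore] -/
theorem intervalIntegrable_log_one_sub_div :
    IntervalIntegrable (fun t : ℝ => Real.log (1 - t) / t) volume 0 1 := by
  have hmeas : Measurable (fun t : ℝ => Real.log (1 - t) / t) :=
    (Real.measurable_log.comp (measurable_const.sub measurable_id)).div measurable_id
  have hmid : IntervalIntegrable (fun t : ℝ => Real.log (1 - t) / t) volume 0 (1 / 2) := by
    refine (intervalIntegrable_const (c := (2 : ℝ))).mono_fun' hmeas.aestronglyMeasurable ?_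
    refine (ae_restrict_mem measurableSet_uIoc).mono fun t ht => ?_
    rw [Set.uIoc_of_le (by norm_num : (0 : ℝ) ≤ 1 / 2)] at ht
    have ht' : |t| ≤ 1 / 2 := abs_le.2 ⟨by linarith [ht.1], ht.2⟩
    show ‖Real.log (1 - t) / t‖ ≤ 2
    rw [Real.norm_eq_abs]
    rcases eq_or_ne t 0 with rfl | ht0
    · simp
    rw [abs_div, div_le_iff₀ (abs_pos.2 ht0)]
    -- `|log(1 − t)| ≤ |t|/(1 − |t|) ≤ 2|t|`
    have ht1 : |t| < 1 := by linarith
    have hb := Real.abs_log_sub_add_sum_range_le ht1 0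
    simp only [Finset.range_zero, Finset.sum_empty, zero_add, pow_one] at hb
    calc |Real.log (1 - t)| ≤ |t| / (1 - |t|) := hb
      _ ≤ |t| / (1 / 2) := div_le_div_of_nonneg_left (abs_nonneg t) (by norm_num) (by linarith)
      _ = 2 * |t| := by ring
  have hright : IntervalIntegrable (fun t : ℝ => Real.log (1 - t) / t) volume (1 / 2) 1 := by
    have hlog : IntervalIntegrable (fun t : ℝ => Real.log (1 - t)) volume (1 / 2) 1 := by
      have h := (intervalIntegral.intervalIntegrable_log' (a := 1 - 1 / 2) (b := 1 - 1)).comp_sub_left 1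
      simpa using h
    have hinv : ContinuousOn (fun t : ℝ => t⁻¹) (Set.uIcc (1 / 2 : ℝ) 1) := by
      refine continuousOn_inv₀.mono fun t ht => ?_
      rw [Set.uIcc_of_le (by norm_num : (1 / 2 : ℝ) ≤ 1)] at ht
      exact ne_of_gt (by linarith [ht.1])
    have h := hlog.mul_continuousOn hinv
    have hfun : (fun t : ℝ => Real.log (1 - t) / t) = fun t => Real.log (1 - t) * t⁻¹ := by
      funext t; rw [div_eq_mul_inv]
    rw [hfun]
    exact h
  exact hmid.trans hright

/-- `∫₀¹ log(1−t)/t dt = −π²/6`. [folklore] -/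
theorem integral_log_one_sub_div : ∫ t in (0 : ℝ)..1, Real.log (1 - t) / t = -(Real.pi ^ 2 / 6) := by
  have h := reDilog_one
  rw [reDilog_def] at h
  linarith

/-- `∫₀¹ log t/(1−t) dt = −π²/6` (reflection `t ↦ 1 − t`). [folklore] -/
theorem integral_log_div_one_sub : ∫ t in (0 : ℝ)..1, Real.log t / (1 - t) = -(Real.pi ^ 2 / 6) := by
  have h := intervalIntegral.integral_comp_sub_left (fun t : ℝ => Real.log t / (1 - t)) (1 : ℝ) (a := 0) (b := 1)
  simp only [sub_sub_cancel, sub_self, sub_zero] at h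
  rw [← h, ← integral_log_one_sub_div]

/-- `t ↦ log t/(1−t)` is interval-integrable on `[0, 1]`. [folklore] -/
theorem intervalIntegrable_log_div_one_sub :
    IntervalIntegrable (fun t : ℝ => Real.log t / (1 - t)) volume 0 1 := by
  have h := (intervalIntegrable_log_one_sub_div).comp_sub_left 1
  simp only [sub_sub_cancel, sub_self, sub_zero] at h
  exact h.symm

/-- `∫₀¹ log t dt = −1`. [folklore] -/
theorem integral_log_zero_one : ∫ t in (0 : ℝ)..1, Real.log t = -1 := by
  rw [integral_log]; simp

/-- `∫₀¹ log(1−t) dt = −1`. [folklore] -/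
theorem integral_log_one_sub : ∫ t in (0 : ℝ)..1, Real.log (1 - t) = -1 := by
  have h := intervalIntegral.integral_comp_sub_left (fun t : ℝ => Real.log t) (1 : ℝ) (a := 0) (b := 1)
  simp only [sub_self, sub_zero] at h
  rw [h, integral_log_zero_one]

/-! ### The singular combination `log t/(1−t)² + 1/(1−t)`: primitive `t log t/(1−t)`, integral `−1` -/

/-- The continuous extension of `−t log t/(1−t)` to `[0,1]` (value `1` at `t = 1`; a local notation). [folklore] -/
local notation "gExt" => (fun t : ℝ => ite (t = 1) (1 : ℝ) (-(t * Real.log t) / (1 - t)))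

/-- `−t log t/(1−t) → 1` as `t → 1` (the derivative of `log` at `1`). [folklore] -/
theorem tendsto_mul_log_div : Tendsto (fun t : ℝ => -(t * Real.log t) / (1 - t)) (𝓝[≠] 1) (𝓝 1) := by
  -- `log t/(t−1) → 1` (derivative of `log` at `1`), times `t → 1`
  have hslope : Tendsto (fun t : ℝ => (Real.log t - Real.log 1) / (t - 1)) (𝓝[≠] 1) (𝓝 1) := by
    have hd : HasDerivAt Real.log (1⁻¹ : ℝ) 1 := Real.hasDerivAt_log one_ne_zero
    rw [inv_one] at hd
    have := hd.tendsto_slope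
    simpa [slope_fun_def_field] using this
  have hid : Tendsto (fun t : ℝ => t) (𝓝[≠] 1) (𝓝 1) := tendsto_nhdsWithin_of_tendsto_nhds tendsto_id
  have hmul := hid.mul hslope
  rw [mul_one] at hmul
  refine hmul.congr' ?_
  filter_upwards [self_mem_nhdsWithin] with t ht
  rw [Real.log_one, sub_zero]
  have h1 : t - 1 ≠ 0 := sub_ne_zero.2 ht
  have h2 : 1 - t ≠ 0 := fun h => h1 (by linarith)
  field_simp
  ring

/-- The extension of `−t log t/(1−t)` by `1` at `t = 1` is continuous on `[0,1]`. [folklore] -/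
theorem continuousOn_gExt : ContinuousOn gExt (Icc 0 1) := by
  intro t ht
  by_cases h1 : t = 1
  · subst h1
    -- continuity at 1 within Icc
    have key : Tendsto gExt (𝓝[≠] 1) (𝓝 1) := by
      refine tendsto_mul_log_div.congr' ?_
      filter_upwards [self_mem_nhdsWithin] with t ht
      have ht' : t ≠ 1 := ht
      simp [ht']
    have : ContinuousWithinAt gExt ({1}ᶜ) 1 := by
      rw [ContinuousWithinAt]; simpa using key
    have h2 : ContinuousWithinAt gExt (insert (1:ℝ) {1}ᶜ) 1 := this.insert
    exact h2.mono (fun x _ => by by_cases hx : x = 1 <;> simp [hx])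
  · -- away from 1: the formula
    have hcont : ContinuousAt (fun t : ℝ => -(t * Real.log t) / (1 - t)) t := by
      have hml : Continuous fun t : ℝ => t * Real.log t := Real.continuous_mul_log
      exact ((hml.neg).continuousAt).div (by fun_prop) (sub_ne_zero.2 (Ne.symm h1))
    have heq : gExt =ᶠ[𝓝 t] fun t => -(t * Real.log t) / (1 - t) := by
      filter_upwards [isOpen_ne.mem_nhds h1] with s hs
      simp [hs]
    exact (hcont.congr heq.symm).continuousWithinAt

/-- On `(0,1)` that extension has derivative `−(log t/(1−t)² + 1/(1−t))`. [folklore] -/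
theorem hasDerivAt_gExt {t : ℝ} (ht : t ∈ Ioo (0 : ℝ) 1) :
    HasDerivAt gExt (-(Real.log t / (1 - t) ^ 2 + 1 / (1 - t))) t := by
  have h0 : t ≠ 0 := ht.1.ne'
  have h1 : 1 - t ≠ 0 := by have := ht.2; intro e; linarith
  have hf : HasDerivAt (fun t : ℝ => -(t * Real.log t) / (1 - t))
      ((-(Real.log t + 1) * (1 - t) - -(t * Real.log t) * (-1)) / (1 - t) ^ 2) t := by
    have hml := (Real.hasDerivAt_mul_log h0).neg
    have hden : HasDerivAt (fun t : ℝ => 1 - t) (-1) t := by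
      simpa using (hasDerivAt_id t).const_sub 1
    exact hml.div hden h1
  have heq : gExt =ᶠ[𝓝 t] fun t => -(t * Real.log t) / (1 - t) := by
    filter_upwards [isOpen_ne.mem_nhds (show t ≠ 1 from ht.2.ne)] with s hs
    simp [hs]
  refine (hf.congr_of_eventuallyEq heq).congr_deriv ?_
  field_simp
  ring

/-- `log t/(1−t)² + 1/(1−t) ≤ 0` on `(0,1)` (from `log t ≤ t − 1`). [folklore] -/
theorem u4_nonpos {t : ℝ} (ht : t ∈ Ioo (0 : ℝ) 1) : Real.log t / (1 - t) ^ 2 + 1 / (1 - t) ≤ 0 := by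
  have h1 : 0 < 1 - t := by linarith [ht.2]
  have hlog : Real.log t ≤ t - 1 := Real.log_le_sub_one_of_pos ht.1
  have : Real.log t / (1 - t) ^ 2 + 1 / (1 - t) = (Real.log t + (1 - t)) / (1 - t) ^ 2 := by
    field_simp
  rw [this]
  exact div_nonpos_of_nonpos_of_nonneg (by linarith) (by positivity)

/-- `t ↦ log t/(1−t)² + 1/(1−t)` is interval-integrable on `[0,1]`, with integral `−1`. [folklore] -/
theorem intervalIntegrable_u4 :
    IntervalIntegrable (fun t : ℝ => Real.log t / (1 - t) ^ 2 + 1 / (1 - t)) volume 0 1 := by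
  have h := intervalIntegrable_deriv_of_nonneg (a := (0:ℝ)) (b := 1) (g := gExt)
    (g' := fun t => -(Real.log t / (1 - t) ^ 2 + 1 / (1 - t)))
    (by rw [uIcc_of_le zero_le_one]; exact continuousOn_gExt)
    (by intro t ht; rw [min_eq_left zero_le_one, max_eq_right zero_le_one] at ht; exact hasDerivAt_gExt ht)
    (by intro t ht; rw [min_eq_left zero_le_one, max_eq_right zero_le_one] at ht
        have := u4_nonpos ht; linarith)
  convert h.neg using 1
  funext t
  simp

/-- `∫₀¹ (log t/(1−t)² + 1/(1−t)) dt = −1`. [folklore] -/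
theorem integral_u4 : ∫ t in (0 : ℝ)..1, (Real.log t / (1 - t) ^ 2 + 1 / (1 - t)) = -1 := by
  have h := integral_eq_sub_of_hasDerivAt_of_le zero_le_one continuousOn_gExt
    (fun t ht => hasDerivAt_gExt ht) intervalIntegrable_u4.neg
  -- h : ∫ -(…) = gExt 1 - gExt 0
  rw [intervalIntegral.integral_neg] at h
  norm_num at h
  simp only [one_div]
  linarith

/-! ### The last one-variable integrand `G₄` and its integral `5/6 − π²/18` -/

/-- `G₄(a) = 1/2 + (1−a)log(1−a)/(6a) − 1/(3(1−a)) + a(a−3)log a/(6(1−a)²)` (local notation). [folklore] -/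
local notation "G4" => (fun a : ℝ => 1 / 2 + (1 - a) * Real.log (1 - a) / (6 * a) - 1 / (3 * (1 - a)) +
  a * (a - 3) * Real.log a / (6 * (1 - a) ^ 2))

/-- The decomposition of `G₄` on `(0,1)` into the five integrable pieces. [folklore] -/
theorem G4_eqOn : EqOn G4 (fun a : ℝ => 1 / 2 + (1 / 6) * (Real.log (1 - a) / a) - (1 / 6) * Real.log (1 - a)
    + (1 / 6) * Real.log a + (1 / 6) * (Real.log a / (1 - a))
    - (1 / 3) * (Real.log a / (1 - a) ^ 2 + 1 / (1 - a))) (Ioo 0 1) := by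
  intro a ha
  have h0 : a ≠ 0 := ha.1.ne'
  have h1 : 1 - a ≠ 0 := by have := ha.2; intro e; linarith
  simp only
  field_simp
  ring

/-- The combination is interval-integrable on `[0,1]` with integral `5/6 − π²/18`. [folklore] -/
theorem integral_pieces :
    IntervalIntegrable (fun a : ℝ => 1 / 2 + (1 / 6) * (Real.log (1 - a) / a) - (1 / 6) * Real.log (1 - a)
      + (1 / 6) * Real.log a + (1 / 6) * (Real.log a / (1 - a))
      - (1 / 3) * (Real.log a / (1 - a) ^ 2 + 1 / (1 - a))) volume 0 1 ∧
    ∫ a in (0 : ℝ)..1, (1 / 2 + (1 / 6) * (Real.log (1 - a) / a) - (1 / 6) * Real.log (1 - a)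
      + (1 / 6) * Real.log a + (1 / 6) * (Real.log a / (1 - a))
      - (1 / 3) * (Real.log a / (1 - a) ^ 2 + 1 / (1 - a))) = 5 / 6 - Real.pi ^ 2 / 18 := by
  have i0 : IntervalIntegrable (fun _ : ℝ => (1 / 2 : ℝ)) volume 0 1 := intervalIntegrable_const
  have i1 := (intervalIntegrable_log_one_sub_div).const_mul (1 / 6 : ℝ)
  have i2 := (intervalIntegrable_log_one_sub).const_mul (1 / 6 : ℝ)
  have i3 := (intervalIntegral.intervalIntegrable_log' (a := (0:ℝ)) (b := 1)).const_mul (1 / 6 : ℝ)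
  have i4 := (intervalIntegrable_log_div_one_sub).const_mul (1 / 6 : ℝ)
  have i5 := (intervalIntegrable_u4).const_mul (1 / 3 : ℝ)
  have hint := ((((i0.add i1).sub i2).add i3).add i4).sub i5
  refine ⟨hint, ?_⟩
  rw [intervalIntegral.integral_sub ((((i0.add i1).sub i2).add i3).add i4) i5,
    intervalIntegral.integral_add (((i0.add i1).sub i2).add i3) i4,
    intervalIntegral.integral_add ((i0.add i1).sub i2) i3,
    intervalIntegral.integral_sub (i0.add i1) i2,
    intervalIntegral.integral_add i0 i1,
    intervalIntegral.integral_const_mul, intervalIntegral.integral_const_mul, intervalIntegral.integral_const_mul,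
    intervalIntegral.integral_const_mul, intervalIntegral.integral_const_mul,
    integral_log_one_sub_div, integral_log_one_sub, integral_log_zero_one, integral_log_div_one_sub, integral_u4,
    intervalIntegral.integral_const]
  simp
  ring

/-- **`G₄` is integrable on `(0,1)` with `∫_{(0,1)} G₄ = 5/6 − π²/18`.** [folklore] -/
theorem integral_G4 : IntegrableOn G4 (Ioo 0 1) ∧ ∫ a in Ioo (0 : ℝ) 1, G4 a = 5 / 6 - Real.pi ^ 2 / 18 := by
  obtain ⟨hint, hval⟩ := integral_pieces
  have hIoc : IntegrableOn (fun a : ℝ => 1 / 2 + (1 / 6) * (Real.log (1 - a) / a) - (1 / 6) * Real.log (1 - a)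
      + (1 / 6) * Real.log a + (1 / 6) * (Real.log a / (1 - a))
      - (1 / 3) * (Real.log a / (1 - a) ^ 2 + 1 / (1 - a))) (Ioc 0 1) := by
    have := hint.1
    exact this
  have hIoo := (hIoc.mono_set Ioo_subset_Ioc_self).congr_fun G4_eqOn.symm measurableSet_Ioo
  refine ⟨hIoo, ?_⟩
  rw [setIntegral_congr_fun measurableSet_Ioo G4_eqOn, ← integral_Ioc_eq_integral_Ioo,
    ← intervalIntegral.integral_of_le zero_le_one, hval]

end Summit.KontsevichZagierPeriods.Zeta5Search.WedgeDictionarySumRule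

end
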